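import Summits.BirchSwinnertonDyer.Rank1Residual.Additive.X3GordBranchPAdicGrossZagier
import Summits.BirchSwinnertonDyer.Rank1Residual.AdditivePotMult.PotMultRankOneWuthrichCertificate
import Summits.BirchSwinnertonDyer.Rank1Residual.AdditivePotMult.PotMultDelbourgo2002Bridge
import HarnessLib

/-!
# T-O7c (vi): the X3♯(M) twins — potentially MULTIPLICATIVE additive prime with REDUCIBLE `E[p]`, EVERY
# odd `p` (`p = 3` included), analytic rank one: the UPPER half from [typed (M) `p`-adic Gross–Zagier +
# Wuthrich 2014 Thm. 16 (published)], the CONVERSE [`BSD(E,p)` ∧ branch IMC on `E♭` ∧ (B) ⟹ typed (M)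
# `p`-adic GZ], and the loop CLOSED `BSD(E,p) ⟺ ∀ (B)-data, BranchPAdicGrossZagierMultAt` (cell
# `b2b-bsdres`, team n1011, seat p01 GEN 2, OWNERS row T-O7c; the X3 twin of
# `PotMultBranchPAdicGrossZagierConverse.lean`, `BranchPAdicGrossZagierUpperHalf.lean` §3 and
# `BranchPAdicGrossZagierIff.lean` §3; the UPPER brick is n1011-p12's
# `AdditivePotMult.isTorsion_and_exists_iota_eq_of_wuthrichHalf` (T-O7KM-X3, p254447) BY NAME)

HONEST FRAMING (cell `b2b-bsdres`, run/shared/lean/b2b/bsd-rank1-residual/, verbatim in every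
file): prove what is provable now; shrink each hard class to its core with data; no claim beyond
stated classes. Research routes; census output = EVIDENCE / conjecture items, never a Literature
fact; RESIDUAL-MAP marks change only by signed lines. §I O7 stays OPEN; X3♯(M) stays
CONSTRUCTION-SHAPED; nothing is booked; no label changes. COVERAGE (stated first, referee 1
proviso): X3♯(M) — `E/ℚ` additive at the ODD prime `p`, potentially multiplicative (`E = E♭ ⊗ χ_{p*}`,
`E♭ = V` multiplicative at `p`, split or non-split; both parities of `(p−1)/2`; `p = 3` INCLUDED), with
REDUCIBLE `E[p]` (`ClassX3M W p = ClassX3 W p ∧ PotMult W p ∧ p ≠ 2`), `E` of analytic rank `1`. NO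
surjectivity / tower / `p ≥ 5` / CM / non-anomalous binder anywhere in this file: the published UPPER
half is Wuthrich 2014 Thm. 16 on the `ω^{(p−1)/2}`-eigencomponent of the SEMISTABLE `E♭` with reducible
`E♭[p]` (`Wuthrich2014.thm16_halfEigenCharIdeal_dvd_cyclotomicPrime`, binder `hW16` — the same binder as
p12's T-O7KM-X3 and additive-p2's X3 files), which needs NO image hypothesis; on (M) Delbourgo's
`ℓ_p = 1` and "no CM" are AUTOMATIC (`PotMult.reductionNonAnomalous`, `PotMult.not_hasCM`). A height
datum `Dh` with Delbourgo's (B)-clauses and the Schneider rider enters where the exact leading term is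
used. NO definition, NO Literature fact minted, NO `_holds`; theorems only. CAVEAT (p10, inherited, as
on every X3 file): for REDUCIBLE `E♭[p]` the Néron-normalised typed LOWER `QuadraticBranchLowerDivisibilityAt
E♭ p` is OUR conjecture and may be off by a `p`-power on some rows — it is a HYPOTHESIS below (`hc`),
nothing is asserted.

## What

* §1 `ClassX3M.missingUpperBoundAt_rankOne_of_wuthrichHalf_of_branchPAdicGrossZagierMult`: typed (M)
  `p`-adic GZ for ONE (B)-datum with the rider + Wuthrich's half ⟹ `Typed.MissingUpperBoundAt W p`
  (twist datum `(V = E♭, C, f, B, ϖ)` DISCHARGED: `ClassX3M.exists_mult_pStar_twist_model`, `hmodD`, the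
  branch series of the reduction sign, the period ratio of the parity; `E♭[p]` reducible by
  additive-p1's `irr_iff_of_model_twist`); the valuation bookkeeping is this seat's
  `missingUpperBoundAt_rankOne_of_iota_eq_of_pgz` (`BranchPAdicGrossZagierUpperHalf.lean` §1).
* §2 CONVERSE `ClassX3M.branchPAdicGrossZagierMultAt_of_bsdp_of_quadraticBranchLower_of_wuthrichHalf`:
  `BSDp W p` ∧ (B) for `Dh` ∧ rider ∧ p10's LOWER on every multiplicative twist model (`hc`) ∧ Wuthrich's
  half ⟹ `BranchPAdicGrossZagierMultAt W p Dh` — UPPER from p12's brick, LOWER pulled back along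
  additive-p2's descent `SelmerDualData.exists_chiEigenInCyclotomic` exactly as in the big-image (M)
  converse, tail = the cell-agnostic core `exists_unit_pgz_of_lower_of_upper_of_bsdp`
  (`X3GordBranchPAdicGrossZagier.lean` §0); + the `∀ Dh` form.
* §3 the forward LOWER class form (gen 1's `PotMult.…` restricted to X3♯(M)), `BSDp` from [LOWER ∧
  Wuthrich ∧ Delbourgo (M) (`hDelM`, A190) ∧ rider ∧ typed (M) `p`-adic GZ ∀ (B)-data], and the iff
  `BSDp W p ↔ ∀ Dh, LeadingTermClauses W p Dh → BranchPAdicGrossZagierMultAt W p Dh` under the rider ∀.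
So, with `BranchPAdicGrossZagierIff.lean` ((M) ∩ big image) and `X3GordBranchPAdicGrossZagierIff.lean`
(X3♯(G-ord)), the reading "GIVEN the branch IMC and Delbourgo (A)+(B) with the rider, `BSD(E,p)` ⟺ the
typed branch `p`-adic Gross–Zagier for every (B)-datum" is kernel-checked on EVERY semistable-twist row
type of O7-ord — (G-ord) and (M), big image and reducible — at every odd `p` incl. `3`. The CERTIFICATE-
version literal iff on X3♯(M) (no LOWER input, one unit certificate) is n1011-p12's (lead offer R5-29
(n)); disjoint hypotheses.

References: [Wuthrich2014] Thm. 16 (p. 397), §3 (p. 390); [Delbourgo2002] Thm. (A), (B), Hypothesis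
p. 39, Example p. 40; [GreenbergLNM1716] §5; [MazurTateTeitelbaum1986Invent] §I.10, §I.13–I.14;
[Miller2011LMS] Def. 1.1; [SkinnerUrban2014] Thm. 3.6.4 (shape of the LOWER input).
-/

noncomputable section

open scoped Classical MatrixGroups ModularForm NumberField

open CongruenceSubgroup WeierstrassCurve NumberField Literature.NumberTheory.EllipticCurves
  Literature.NumberTheory.EllipticCurves.ModularForms
  Literature.NumberTheory.EllipticCurves.Rank1Residual
  Literature.NumberTheory.EllipticCurves.Rank1Residual.Typed
  Literature.NumberTheory.EllipticCurves.Delbourgo2002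
  Literature.NumberTheory.GaloisRepresentations
  IsDedekindDomain

namespace Summit.BirchSwinnertonDyer.Rank1Residual.AdditivePotMult

open Additive

variable {W : WeierstrassCurve ℚ} [W.IsElliptic] [W.IsGloballyMinimal] {p : ℕ} [hp : Fact p.Prime]

/-! ### §1 X3♯(M): the UPPER half from the typed (M) `p`-adic GZ + Wuthrich 2014 Thm. 16 -/

/-- **X3♯(M) (reducible `E[p]`), EVERY odd `p` (`p = 3` included), `r_an = 1`: the typed (M) `p`-adic
Gross–Zagier for ONE (B)-datum with the rider + Wuthrich's half-eigenspace divisibility (published,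
Thm. 16, NO image hypothesis; through n1011-p12's full-series brick
`isTorsion_and_exists_iota_eq_of_wuthrichHalf`) ⟹ the UPPER half `Typed.MissingUpperBoundAt W p`.**
The twist datum is DISCHARGED; NO tower / CM / non-anomalous binder. X3 twin of
`PotMult.missingUpperBoundAt_rankOne_of_katoHalf_of_branchPAdicGrossZagierMult`.
[cite: Wuthrich2014, Thm. 16 (p. 397), §3 (p. 390)] [cite: Delbourgo2002, Theorem (B) (p. 40)]
[cite: Miller2011LMS, Def. 1.1] -/
theorem ClassX3M.missingUpperBoundAt_rankOne_of_wuthrichHalf_of_branchPAdicGrossZagierMult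
    (hW16 : Wuthrich2014.thm16_halfEigenCharIdeal_dvd_cyclotomicPrime)
    (hGZK : rank_eq_analyticRank_of_analyticRank_le_one) (hmod : hasEntireLFunction_rat)
    (hmodD : nonempty_modularParametrizationData) (hX : ClassX3M W p) (hr : W.analyticRank = 1)
    {Dh : PAdicHeightData W p} (hB : LeadingTermClauses W p Dh) (hS : SchneiderConjecture Dh)
    (hGZ : BranchPAdicGrossZagierMultAt W p Dh) : MissingUpperBoundAt W p := by
  have hp2 : p ≠ 2 := hX.p_ne_two
  obtain ⟨V, iV, iVm, C, hV, hC⟩ := hX.exists_mult_pStar_twist_model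
  haveI : NeZero (V.conductorNorm ℤ) := ⟨(V.conductorNorm_pos_holds).ne'⟩
  obtain ⟨Dm⟩ := hmodD V
  obtain ⟨ϖ, hϖ⟩ := exists_periodRatio_parity (p := p) V Dm
  -- `V[p]` is reducible with `W[p]`
  have hirrV : ¬ V.HasIrreducibleModPGaloisRep p := fun hVirr ↦
    hX.classX3.1 ((irr_iff_of_model_twist (W := V) (p := p) (pStar_ne_zero p) ⟨C, hC⟩).mpr hVirr)
  -- the branch series of the reduction sign
  obtain ⟨B, hVB⟩ : ∃ B : PowerSeries ℚ_[p],
      (V.HasSplitMultiplicativeReductionAtPrime p ∧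
          B = if Even (p / 2) then padicLFunctionPlusBranchMult Dm.f (1 : ℚ_[p]) (p / 2)
            else padicLFunctionMinusBranchMult Dm.f (1 : ℚ_[p]) (p / 2)) ∨
        (V.HasMultiplicativeReductionAtPrime p ∧ ¬ V.HasSplitMultiplicativeReductionAtPrime p ∧
          B = if Even (p / 2) then padicLFunctionPlusBranchMult Dm.f (-1 : ℚ_[p]) (p / 2)
            else padicLFunctionMinusBranchMult Dm.f (-1 : ℚ_[p]) (p / 2)) := by
    by_cases hs : V.HasSplitMultiplicativeReductionAtPrime p
    · exact ⟨_, Or.inl ⟨hs, rfl⟩⟩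
    · exact ⟨_, Or.inr ⟨hV, hs, rfl⟩⟩
  obtain ⟨κ, γ, hκ, hγ, hγ', D, fE, hchar⟩ := exists_cyclotomic_dualData_generator W p
  haveI : Module.Finite (IwasawaAlgebra p) D.X :=
    SelmerDualData.module_finite_of_isCyclotomic (W := W) (κ := κ) hκ D hγ
  -- UPPER: Wuthrich's half on the multiplicative branch of `E♭` (full series, NO tower)
  obtain ⟨hXt, g, hg, u, hι⟩ := isTorsion_and_exists_iota_eq_of_wuthrichHalf hW16 hp2 V C hC hirrV hκ
    hγ hγ' Dm.isNewformOf D B (Or.inr hVB) ϖ hϖ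
  obtain ⟨u', q, hlead, hpgz⟩ := hGZ V B hp2 ⟨C, hC⟩ hVB Dm.isNewformOf ϖ hϖ
  exact missingUpperBoundAt_rankOne_of_iota_eq_of_pgz hp2 hGZK hmod hr hB hS hκ hγ hγ' D hXt hchar hg
    hι hlead hpgz

/-! ### §2 X3♯(M): the CONVERSE (`BSD(E,p)` ∧ branch IMC on `E♭` ∧ (B) ⟹ typed (M) `p`-adic GZ) -/

/-- **CONVERSE on X3♯(M) (reducible `E[p]`), EVERY odd `p` (`p = 3` included), rank one.** `BSD(E,p)`
(Miller) ∧ the (B)-clauses for `Dh` with the Schneider rider ∧ p10's LOWER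
`QuadraticBranchLowerDivisibilityAt V p` for every multiplicative twist model `C • V^{(p*)} = W` (`hc`;
OUR conjecture, normalisation caveat on reducible rows) ∧ Wuthrich's half (`hW16`, published, NO image
hypothesis) ⟹ `BranchPAdicGrossZagierMultAt W p Dh`: for every admissible `(V, C, f, B, ϖ)`,
`L'(E,1) = q·Ω_E·Reg_∞` and `ϖ·[T¹]B·log_p γ = u·q·Reg_p(E,Dh)`, `u ∈ ℤ_p^×`. UPPER = p12's brick;
LOWER pulled back along additive-p2's descent `SelmerDualData.exists_chiEigenInCyclotomic` (same
characteristic ideal); tail = the core `exists_unit_pgz_of_lower_of_upper_of_bsdp`. `ℓ_p = 1` AUTOMATIC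
on (M). NO Birch / Pal / GZK / surjectivity binder. The X3 twin of
`PotMult.branchPAdicGrossZagierMultAt_of_bsdp_of_quadraticBranchLower_of_katoHalf`.
[cite: Wuthrich2014, Thm. 16 (p. 397)] [cite: Delbourgo2002, Theorem (B) (p. 40) and Hypothesis (p. 39)]
[cite: GreenbergLNM1716, §5 (PDF p. 143)] [cite: Miller2011LMS, Def. 1.1] -/
theorem ClassX3M.branchPAdicGrossZagierMultAt_of_bsdp_of_quadraticBranchLower_of_wuthrichHalf
    (hW16 : Wuthrich2014.thm16_halfEigenCharIdeal_dvd_cyclotomicPrime)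
    (hmod : hasEntireLFunction_rat) (hX : ClassX3M W p) (hr : W.analyticRank = 1) (hbsd : BSDp W p)
    (hc : ∀ (V : WeierstrassCurve ℚ) [V.IsElliptic] [V.IsGloballyMinimal],
      (∃ C : VariableChange ℚ, C • V.quadraticTwist ((-1) ^ (p / 2) * p : ℚ) = W) →
        QuadraticBranchLowerDivisibilityAt V p)
    {Dh : PAdicHeightData W p} (hB : LeadingTermClauses W p Dh) (hS : SchneiderConjecture Dh) :
    BranchPAdicGrossZagierMultAt W p Dh := by
  intro V _ _ N _ f B hp2 hVW hVB hf ϖ hϖ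
  have hna : ReductionNonAnomalous W p := hX.potMult.reductionNonAnomalous
  obtain ⟨C, hC⟩ := hVW
  -- `V[p]` is reducible with `W[p]`
  have hirrV : ¬ V.HasIrreducibleModPGaloisRep p := fun hVirr ↦
    hX.classX3.1 ((irr_iff_of_model_twist (W := V) (p := p) (pStar_ne_zero p) ⟨C, hC⟩).mpr hVirr)
  -- the cyclotomic setting, a dual datum, a generator of `char_Λ X(E/ℚ_∞)`
  obtain ⟨κ, γ, hκ, hγ, hγ', D, fE, hcharE⟩ := exists_cyclotomic_dualData_generator W p
  haveI : Module.Finite (IwasawaAlgebra p) D.X :=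
    SelmerDualData.module_finite_of_isCyclotomic (W := W) (κ := κ) hκ D hγ
  -- UPPER (Wuthrich's half on the multiplicative branch of `E♭`, full series, n1011-p12's brick; NO tower)
  obtain ⟨hXt, g, hg, u, hι⟩ := isTorsion_and_exists_iota_eq_of_wuthrichHalf hW16 hp2 V C hC hirrV hκ
    hγ hγ' hf D B (Or.inr hVB) ϖ hϖ
  -- LOWER (p10's `E♭`-level conjecture, pulled back along additive-p2's descent): `ι fE = ι h · (ϖ·B)`
  haveI hcycL : IsCyclotomicExtension {p} ℚ (CyclotomicField p ℚ) := by
    have h : (CyclotomicField.algebra p ℚ : Algebra ℚ (CyclotomicField p ℚ)) =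
        DivisionRing.toRatAlgebra := Subsingleton.elim _ _
    exact h ▸ CyclotomicField.isCyclotomicExtension p ℚ
  obtain ⟨K, θ, hK2, hθ, hθ2⟩ := exists_intermediateField_sq_eq_pStar p (CyclotomicField p ℚ) hp2
  haveI : NumberField K := NumberField.of_module_finite ℚ K
  haveI : IsGalois ℚ K := isGalois_of_finrank_eq_two K hK2
  haveI := normal_galRange K hK2 (sigmaQ_ne_one K hK2 hθ hθ2)
  haveI := normal_galRange_cyclotomic p (CyclotomicField p ℚ)
  haveI : (V.quadraticTwist ((-1 : ℚ) ^ (p / 2) * p)).IsElliptic :=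
    V.isElliptic_quadraticTwist (pStar_ne_zero p)
  obtain ⟨γ₁, hγ₁KF, hκγ₁, ⟨g₀, hg₀, hγ₁eq⟩, D', hchar', -⟩ :=
    SelmerDualData.exists_chiEigenInCyclotomic p (CyclotomicField p ℚ) V K hK2 hθ hθ2 κ hC hp2 D
  have hmem : fE ∈ Literature.NumberTheory.EllipticCurves.Module.charIdeal (IwasawaAlgebra p) D'.X := by
    rw [hchar', hcharE]
    exact Ideal.mem_span_singleton_self fE
  obtain ⟨h, hlow⟩ := hc V ⟨C, hC⟩ K (CyclotomicField p ℚ) (κ := κ) (γ := γ₁) (f := f) B hp2 hK2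
    ⟨θ, hθ2⟩ (Or.inr hVB) hκ (isTopGenerator_of_kappa_eq κ hκγ₁ hγ)
    (isCyclotomicVariable_of_eq_mul p κ hκ hg₀ hγ₁eq hγ') (Subgroup.mem_inf.mp hγ₁KF).1
    (Subgroup.mem_inf.mp hγ₁KF).2 hf D' ϖ hϖ fE hmem
  -- the common tail: (B) + rider + `ℓ = 1` + `BSD(E,p)` pin the unit
  exact exists_unit_pgz_of_lower_of_upper_of_bsdp hp2 hmod hr hbsd hB hS hna hκ hγ hγ' D hXt hcharE hg hι
    hlow

/-- **`∀ Dh` form** (the exact converse of the hypothesis shape `hGZ` of the forward class form §3,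
minus the rider which is an input here): on X3♯(M), every odd `p`, `r_an = 1`: `BSD(E,p)` ∧ p10's LOWER
∧ Wuthrich's half ⟹ for EVERY height datum with the (B)-clauses and the rider,
`BranchPAdicGrossZagierMultAt W p Dh`. [cite: Wuthrich2014, Thm. 16 (p. 397)]
[cite: Delbourgo2002, Theorem (B) (p. 40)] [cite: Miller2011LMS, Def. 1.1] -/
theorem ClassX3M.forall_branchPAdicGrossZagierMultAt_of_bsdp_of_quadraticBranchLower_of_wuthrichHalf
    (hW16 : Wuthrich2014.thm16_halfEigenCharIdeal_dvd_cyclotomicPrime)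
    (hmod : hasEntireLFunction_rat) (hX : ClassX3M W p) (hr : W.analyticRank = 1) (hbsd : BSDp W p)
    (hc : ∀ (V : WeierstrassCurve ℚ) [V.IsElliptic] [V.IsGloballyMinimal],
      (∃ C : VariableChange ℚ, C • V.quadraticTwist ((-1) ^ (p / 2) * p : ℚ) = W) →
        QuadraticBranchLowerDivisibilityAt V p) :
    ∀ Dh : PAdicHeightData W p, LeadingTermClauses W p Dh → SchneiderConjecture Dh →
      BranchPAdicGrossZagierMultAt W p Dh :=
  fun _ hB hS ↦ hX.branchPAdicGrossZagierMultAt_of_bsdp_of_quadraticBranchLower_of_wuthrichHalf hW16 hmod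
    hr hbsd hc hB hS

/-! ### §3 X3♯(M): the forward LOWER class form, `BSD(E,p)` and the loop CLOSED (iff) -/

/-- **X3♯(M), EVERY odd `p`, `r_an = 1`: the LOWER half from the two typed inputs of the (M) route**
(p10's `QuadraticBranchLowerDivisibilityAt` on every multiplicative twist model and, for every (B)-datum,
the rider + `BranchPAdicGrossZagierMultAt W p Dh`); Delbourgo 2002 (M) (A190, `hDelM`), modularity,
`hmodD`, GZK published. Gen 1's image-free `PotMult.missingLowerBoundAt_rankOne_of_quadraticBranchLower_
of_branchPAdicGrossZagierMult` restricted to X3♯(M) (`ℓ = 1`, no CM AUTOMATIC).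
[cite: Delbourgo2002, Theorem (A), (B), Hypothesis (p. 39), Example (p. 40)] [cite: Miller2011LMS, Def. 1.1] -/
theorem ClassX3M.missingLowerBoundAt_rankOne_of_quadraticBranchLower_of_branchPAdicGrossZagierMult
    (hDelM : Delbourgo2002.mainTheorem_potMult) (hmod : hasEntireLFunction_rat)
    (hmodD : nonempty_modularParametrizationData)
    (hGZK : rank_eq_analyticRank_of_analyticRank_le_one) (hX : ClassX3M W p) (hr : W.analyticRank = 1)
    (hc : ∀ (V : WeierstrassCurve ℚ) [V.IsElliptic] [V.IsGloballyMinimal],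
      (∃ C : VariableChange ℚ, C • V.quadraticTwist ((-1) ^ (p / 2) * p : ℚ) = W) →
        QuadraticBranchLowerDivisibilityAt V p)
    (hGZ : ∀ Dh : PAdicHeightData W p, LeadingTermClauses W p Dh →
      SchneiderConjecture Dh ∧ BranchPAdicGrossZagierMultAt W p Dh) :
    MissingLowerBoundAt W p :=
  hX.potMult.missingLowerBoundAt_rankOne_of_quadraticBranchLower_of_branchPAdicGrossZagierMult hDelM hmod
    hmodD hGZK hX.p_ne_two hr hc hGZ

/-- **X3♯(M) (reducible `E[p]`), EVERY odd `p` (`p = 3` included), `r_an = 1`: `BSD(E,p)` from the branch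
IMC on `E♭`'s quadratic branch (p10's typed LOWER `hc` + Wuthrich's half `hW16`, published, NO image
hypothesis) ∧ Delbourgo 2002 (A)+(B) in case (M) (A190, `hDelM`) ∧ [rider ∧ typed (M) `p`-adic GZ for
every (B)-datum].** Lower half: the class form above; upper half: §1. NO surjectivity / tower / CM / hna
binder. X3♯(M) stays CONSTRUCTION-SHAPED; nothing booked.
[cite: Delbourgo2002, Theorem (A), (B), Hypothesis (p. 39), Example (p. 40)]
[cite: Wuthrich2014, Thm. 16 (p. 397)] [cite: Miller2011LMS, Def. 1.1] -/
theorem ClassX3M.bsdp_rankOne_of_quadraticBranchLower_of_wuthrichHalf_of_branchPAdicGrossZagierMult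
    (hDelM : Delbourgo2002.mainTheorem_potMult)
    (hW16 : Wuthrich2014.thm16_halfEigenCharIdeal_dvd_cyclotomicPrime)
    (hmod : hasEntireLFunction_rat) (hmodD : nonempty_modularParametrizationData)
    (hGZK : rank_eq_analyticRank_of_analyticRank_le_one) (hX : ClassX3M W p) (hr : W.analyticRank = 1)
    (hc : ∀ (V : WeierstrassCurve ℚ) [V.IsElliptic] [V.IsGloballyMinimal],
      (∃ C : VariableChange ℚ, C • V.quadraticTwist ((-1) ^ (p / 2) * p : ℚ) = W) →
        QuadraticBranchLowerDivisibilityAt V p)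
    (hGZ : ∀ Dh : PAdicHeightData W p, LeadingTermClauses W p Dh →
      SchneiderConjecture Dh ∧ BranchPAdicGrossZagierMultAt W p Dh) : BSDp W p := by
  have hl : MissingLowerBoundAt W p :=
    hX.missingLowerBoundAt_rankOne_of_quadraticBranchLower_of_branchPAdicGrossZagierMult hDelM hmod hmodD
      hGZK hr hc hGZ
  obtain ⟨-, Dh, hB⟩ := hX.delbourgo2002 hDelM
  obtain ⟨hS, hGZDh⟩ := hGZ Dh hB
  have hu : MissingUpperBoundAt W p :=
    hX.missingUpperBoundAt_rankOne_of_wuthrichHalf_of_branchPAdicGrossZagierMult hW16 hGZK hmod hmodD hr hB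
      hS hGZDh
  exact bsdp_of_missingPPartAt W p hGZK (by rw [hr]) (missingPPartAt_of_lower_of_upper W p hl hu)

/-- **THE LOOP CLOSED on X3♯(M) (iff), EVERY odd `p` (`p = 3` included).** X3♯(M), `r_an = 1`; GIVEN
the branch IMC on `E♭` (p10's typed LOWER on every multiplicative twist model + Wuthrich's half),
Delbourgo 2002 (M), modularity, `hmodD`, GZK, and the rider for every (B)-datum (`hSall`):
`BSD(E,p) ⟺` the typed (M) `p`-adic Gross–Zagier holds for every (B)-datum. The X3 twin of
`ClassX4M.bsdp_iff_forall_branchPAdicGrossZagierMultAt_of_quadraticBranchLower_of_katoHalf` — with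
STRICTLY FEWER binders (no `Surj`). [cite: Delbourgo2002, Theorem (A), (B), Example (p. 40)]
[cite: Wuthrich2014, Thm. 16 (p. 397)] [cite: Miller2011LMS, Def. 1.1] -/
theorem ClassX3M.bsdp_iff_forall_branchPAdicGrossZagierMultAt_of_quadraticBranchLower_of_wuthrichHalf
    (hDelM : Delbourgo2002.mainTheorem_potMult)
    (hW16 : Wuthrich2014.thm16_halfEigenCharIdeal_dvd_cyclotomicPrime)
    (hmod : hasEntireLFunction_rat) (hmodD : nonempty_modularParametrizationData)
    (hGZK : rank_eq_analyticRank_of_analyticRank_le_one) (hX : ClassX3M W p) (hr : W.analyticRank = 1)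
    (hc : ∀ (V : WeierstrassCurve ℚ) [V.IsElliptic] [V.IsGloballyMinimal],
      (∃ C : VariableChange ℚ, C • V.quadraticTwist ((-1) ^ (p / 2) * p : ℚ) = W) →
        QuadraticBranchLowerDivisibilityAt V p)
    (hSall : ∀ Dh : PAdicHeightData W p, LeadingTermClauses W p Dh → SchneiderConjecture Dh) :
    BSDp W p ↔
      ∀ Dh : PAdicHeightData W p, LeadingTermClauses W p Dh → BranchPAdicGrossZagierMultAt W p Dh := by
  refine ⟨fun hbsd Dh hB ↦ ?_, fun hGZ ↦ ?_⟩
  · exact hX.branchPAdicGrossZagierMultAt_of_bsdp_of_quadraticBranchLower_of_wuthrichHalf hW16 hmod hr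
      hbsd hc hB (hSall Dh hB)
  · exact hX.bsdp_rankOne_of_quadraticBranchLower_of_wuthrichHalf_of_branchPAdicGrossZagierMult hDelM hW16
      hmod hmodD hGZK hr hc fun Dh hB ↦ ⟨hSall Dh hB, hGZ Dh hB⟩

end Summit.BirchSwinnertonDyer.Rank1Residual.AdditivePotMult

end
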